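import Summits.Parity.BatemanHorn.Theorems.RoughValueTransportDefs
import Literature.NumberTheory.Sieve.PolynomialValuesSieveSequence
import Literature.NumberTheory.Sieve.BatemanHornMertensProduct
import Literature.Barriers.Parity.UniformBatemanHornBunyakovsky
import Summits.Parity.BatemanHorn.Theorems.BalancedSemiprimeLayer.Negative.NatDegreePos
import HarnessLib

/-!
# Route `RoughValueTransport`, crux `BalancedSemiprimeLayer` (stmt-Parity-9469), line
# `rough-relaxed-divisor-sieve` (companion lead c1): sanity anchor —
# `RoughWindowTypeI` holds in degree 1

The lever `stub_roughWindowLever` of the skeleton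
`Cruxes/BalancedSemiprimeLayer/Lines/rough_relaxed_divisor_sieve_c1.lean` proves
`RoughWindowTypeI f i → CoordLayerThin f i` for every coordinate `i` of a Bateman–Horn system `f`;
for coordinates of degree `≥ 3` the Type-I hypothesis `RoughWindowTypeI f i` is the open residual.
This file is the SANITY ANCHOR `stub_roughWindowTypeI_degOne` of that skeleton: the packaging of the
hypothesis (main term `x·(ρᵢ(m)/m)·(ρ_F(e)/e)`, range `posRange f x`, moduli `e ≤ x^c` squarefree
and `m ∈ roughDivWindow dᵢ δ c x`) is right, because in the one cheap regime — degree `dᵢ = 1` — it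
is a theorem: every modulus `m·e ≤ x^{(1+δ)/2 + c} < x` is SMALLER than the number of terms, so each
remainder is `O(1)` by counting complete residue systems.

Proof.  Let `g = fᵢ`, `F = ∏ⱼ fⱼ`, and let `n₀ = n₀(f)` be such that every `fⱼ(n) ≥ 1` for `n ≥ n₀`
(positive leading coefficients), so that `posRange f x ⊇ [n₀, x]`.  For `m` in the rough window and
`e ≤ x^c` squarefree, `(e, m) = 1` (the primes of `m` exceed `x^c ≥` the primes of `e`), so the
admissible pairs of classes `(t mod m, s mod e)` with `m ∣ g(t)`, `e ∣ F(s)` are `ρ_g(m)·ρ_F(e)`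
single classes modulo `me`, each met by `(0, x]` in `x/(me) + O(1)` points
(`abs_card_apIndex_filter_modEq_sub_le`): `|#{n ≤ x : m ∣ g(n), e ∣ F(n)} − x·ρ_g(m)ρ_F(e)/(me)|
≤ ρ_g(m)ρ_F(e)`, and restricting to `posRange f x` costs at most `n₀`.  Here `ρ_F(e) ≤ e ≤ x^c` and
`ρ_g(m) ≤ 1` (`m` squarefree, `ρ_g(p) ≤ deg g = 1` for every prime by Lagrange and
`hasNoFixedPrimeDivisor`, multiplicativity `polyRootCountMod_mul_of_coprime`).  Summing over
`≤ x^c` moduli `e` and `≤ x^{(1+δ)/2} + 1` moduli `m` gives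
`≤ 4x^{2c + (1+δ)/2} ≤ 4x^{13/16} ≤ x^{7/8}` for `c ≤ c₀ = 1/8`, `δ ≤ c`, `x` large; `η = 1/8`.

References: standard (Halberstam–Richert, *Sieve Methods*, §1.4: the remainder of a polynomial
sequence is `O(ρ(d))`); everything used is PROVED in the tree (`card_filter_dvd_eval_eq_sum`,
`abs_card_apIndex_filter_modEq_sub_le`, `polyRootCountMod_mul_of_coprime`,
`BatemanHornMertens.rootCount_single_le_natDegree`, `exists_forall_le_eval_of_leadingCoeff_pos`).
-/

noncomputable section

open Polynomial Filter Finset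
open Literature.NumberTheory.Sieve

namespace Summit.Parity.BatemanHorn.Cruxes.BalancedSemiprimeLayer.RoughRelaxedDivisorSieve

open Summit.Parity.BatemanHorn.Theorems.BalancedSemiprimeLayer.Negative
  (natDegree_pos_of_isBatemanHornSystem)

/-! ### The CRT count of a pair of polynomial congruence conditions on `(0, x]` -/

/-- Double fibration of `#{1 ≤ n ≤ x : m ∣ g(n), e ∣ F(n)}` (`m, e ≥ 1`) over the roots `s` of
`F mod e` and `t` of `g mod m` (`card_filter_dvd_eval_eq_sum` twice). [folklore] -/
theorem card_filter_dvd_pair_eq_sum (g F : ℤ[X]) {m e : ℕ} (hm : 0 < m) (he : 0 < e) (x : ℕ) :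
    #((Ioc 0 x).filter fun n : ℕ => (m : ℤ) ∣ g.eval (n : ℤ) ∧ (e : ℤ) ∣ F.eval (n : ℤ)) =
      ∑ s ∈ (range e).filter (fun s : ℕ => (e : ℤ) ∣ F.eval (s : ℤ)),
        ∑ t ∈ (range m).filter (fun t : ℕ => (m : ℤ) ∣ g.eval (t : ℤ)),
          #((apIndex x e s).filter fun n : ℕ => n ≡ t [MOD m]) := by
  rw [show ((Ioc 0 x).filter fun n : ℕ => (m : ℤ) ∣ g.eval (n : ℤ) ∧ (e : ℤ) ∣ F.eval (n : ℤ)) =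
      ((Ioc 0 x).filter fun n : ℕ => (m : ℤ) ∣ g.eval (n : ℤ)).filter
        (fun n : ℕ => (e : ℤ) ∣ F.eval (n : ℤ)) from (Finset.filter_filter _ _ _).symm,
    card_filter_dvd_eval_eq_sum F _ he]
  refine Finset.sum_congr rfl fun s _ => ?_
  rw [← card_filter_dvd_eval_eq_sum g (apIndex x e s) hm]
  unfold apIndex
  rw [Finset.filter_filter, Finset.filter_filter]
  congr 1
  exact Finset.filter_congr fun n _ => and_comm

/-- **CRT count.**  For coprime `e, m ≥ 1`,
`|#{1 ≤ n ≤ x : m ∣ g(n), e ∣ F(n)} − x·(ρ_g(m)/m)·(ρ_F(e)/e)| ≤ ρ_g(m)·ρ_F(e)`: each of the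
`ρ_F(e)·ρ_g(m)` admissible pairs of classes is one class modulo `em`, met by `(0, x]` in
`x/(em) + O(1)` points (`abs_card_apIndex_filter_modEq_sub_le`). [folklore] -/
theorem abs_card_filter_dvd_pair_sub_le (g F : ℤ[X]) {m e : ℕ} (hm : 0 < m) (he : 0 < e)
    (hem : e.Coprime m) (x : ℕ) :
    |(#((Ioc 0 x).filter fun n : ℕ => (m : ℤ) ∣ g.eval (n : ℤ) ∧ (e : ℤ) ∣ F.eval (n : ℤ)) : ℝ) -
        (x : ℝ) * ((polyRootCountMod ![g] m : ℝ) / m) * ((polyRootCountMod ![F] e : ℝ) / e)| ≤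
      (polyRootCountMod ![g] m : ℝ) * (polyRootCountMod ![F] e) := by
  rw [card_filter_dvd_pair_eq_sum g F hm he x, ← card_filter_dvd_eval_eq_polyRootCountMod g m,
    ← card_filter_dvd_eval_eq_polyRootCountMod F e]
  set T := (range m).filter (fun t : ℕ => (m : ℤ) ∣ g.eval (t : ℤ)) with hT
  set S := (range e).filter (fun s : ℕ => (e : ℤ) ∣ F.eval (s : ℤ)) with hS
  have hm' : (m : ℝ) ≠ 0 := by exact_mod_cast hm.ne'
  have he' : (e : ℝ) ≠ 0 := by exact_mod_cast he.ne'
  have hrw : (x : ℝ) * ((#T : ℝ) / m) * ((#S : ℝ) / e) =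
      ∑ _s ∈ S, ∑ _t ∈ T, (x : ℝ) / ((e : ℝ) * m) := by
    rw [Finset.sum_const, Finset.sum_const, smul_smul, nsmul_eq_mul]
    push_cast
    field_simp
  rw [hrw]
  push_cast
  rw [← Finset.sum_sub_distrib]
  refine (Finset.abs_sum_le_sum_abs _ _).trans ?_
  calc ∑ s ∈ S, |∑ t ∈ T, ((#((apIndex x e s).filter fun n : ℕ => n ≡ t [MOD m]) : ℕ) : ℝ) -
          ∑ _t ∈ T, (x : ℝ) / ((e : ℝ) * m)|
      ≤ ∑ _s ∈ S, ∑ _t ∈ T, (1 : ℝ) := by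
        refine Finset.sum_le_sum fun s _ => ?_
        rw [← Finset.sum_sub_distrib]
        refine (Finset.abs_sum_le_sum_abs _ _).trans (Finset.sum_le_sum fun t _ => ?_)
        exact abs_card_apIndex_filter_modEq_sub_le he hm hem x s t
    _ = (#T : ℝ) * #S := by
        simp only [Finset.sum_const, nsmul_eq_mul, mul_one]
        ring

/-! ### `ρ_g(m) ≤ 1` on squarefree `m` -/

/-- `ρ_g(m) ≤ 1` for squarefree `m` all of whose prime factors `p` have `ρ_g(p) ≤ 1`
(multiplicativity `polyRootCountMod_mul_of_coprime`, splitting off the least prime factor).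
[folklore] -/
theorem polyRootCountMod_single_le_one_of_squarefree (g : ℤ[X]) :
    ∀ m : ℕ, Squarefree m → (∀ p : ℕ, p.Prime → p ∣ m → polyRootCountMod ![g] p ≤ 1) →
      polyRootCountMod ![g] m ≤ 1 := by
  intro m
  induction m using Nat.strong_induction_on with
  | _ m ih =>
  intro hsq hp
  rcases lt_or_ge m 2 with h2 | h2
  · interval_cases m
    · exact absurd hsq not_squarefree_zero
    · exact polyRootCountMod_le _ 1
  · set p := m.minFac with hpdef
    have hq : p.Prime := Nat.minFac_prime (by omega)
    have hpm : p ∣ m := Nat.minFac_dvd m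
    obtain ⟨r, hr⟩ := hpm
    have hr0 : 0 < r := by
      rcases Nat.eq_zero_or_pos r with h | h
      · rw [h, mul_zero] at hr; omega
      · exact h
    have hcop : p.Coprime r := by
      rw [Nat.Prime.coprime_iff_not_dvd hq]
      rintro ⟨s, hs⟩
      have hmul : p * p ∣ m := ⟨s, by rw [hr, hs, mul_assoc]⟩
      have hu := hsq p hmul
      rw [Nat.isUnit_iff] at hu
      exact hq.one_lt.ne' hu
    have hrdvd : r ∣ m := ⟨p, by rw [hr, mul_comm]⟩
    have hrm : r < m := by rw [hr]; nlinarith [hq.one_lt, hr0]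
    have hsqr : Squarefree r := hsq.squarefree_of_dvd hrdvd
    rw [hr, polyRootCountMod_mul_of_coprime g hcop]
    calc polyRootCountMod ![g] p * polyRootCountMod ![g] r ≤ 1 * 1 :=
          Nat.mul_le_mul (hp p hq ⟨r, hr⟩)
            (ih r hrm hsqr fun q hq' hqr => hp q hq' (hqr.trans hrdvd))
      _ = 1 := rfl

/-! ### The positive range and the pointwise remainder bound -/

/-- A Bateman–Horn system is eventually positive: some `n₀` has `fⱼ(n) > 0` for all `j` and all
`n ≥ n₀` (degrees `≥ 1`, positive leading coefficients). [folklore] -/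
theorem exists_forall_eval_pos {k : ℕ} {f : Fin k → ℤ[X]} (hf : IsBatemanHornSystem f) :
    ∃ n₀ : ℕ, ∀ n : ℕ, n₀ ≤ n → ∀ j, 0 < (f j).eval (n : ℤ) := by
  have h : ∀ j : Fin k, ∃ N : ℕ, ∀ n : ℕ, N ≤ n → (1 : ℝ) ≤ (((f j).eval (n : ℤ) : ℤ) : ℝ) :=
    fun j => Literature.Barriers.Parity.exists_forall_le_eval_of_leadingCoeff_pos
      (natDegree_pos_of_isBatemanHornSystem hf j) (hf.leadingCoeff_pos j) 1
  choose N hN using h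
  refine ⟨Finset.univ.sup N, fun n hn j => ?_⟩
  have h1 := hN j n ((Finset.le_sup (Finset.mem_univ j)).trans hn)
  have h2 : (1 : ℤ) ≤ (f j).eval (n : ℤ) := by exact_mod_cast h1
  linarith

/-- `windowPairCount` against the count over all of `(0, x]`: if every `fⱼ(n) > 0` for `n ≥ n₀`,
they differ by at most `n₀`. [folklore] -/
theorem windowPairCount_le_and_le {k : ℕ} (f : Fin k → ℤ[X]) (i : Fin k) {n₀ : ℕ}
    (hn₀ : ∀ n : ℕ, n₀ ≤ n → ∀ j, 0 < (f j).eval (n : ℤ)) (x m e : ℕ) :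
    windowPairCount f i x m e ≤
        #((Ioc 0 x).filter fun n : ℕ =>
          (m : ℤ) ∣ (f i).eval (n : ℤ) ∧ (e : ℤ) ∣ (∏ j, f j).eval (n : ℤ)) ∧
      #((Ioc 0 x).filter fun n : ℕ =>
          (m : ℤ) ∣ (f i).eval (n : ℤ) ∧ (e : ℤ) ∣ (∏ j, f j).eval (n : ℤ)) ≤
        windowPairCount f i x m e + n₀ := by
  unfold windowPairCount
  have hsub : (posRange f x).filter (fun n : ℕ =>
      ((m : ℤ) ∣ (f i).eval (n : ℤ)) ∧ ((e : ℤ) ∣ ∏ j, (f j).eval (n : ℤ))) ⊆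
      (Ioc 0 x).filter fun n : ℕ =>
        (m : ℤ) ∣ (f i).eval (n : ℤ) ∧ (e : ℤ) ∣ (∏ j, f j).eval (n : ℤ) := by
    intro n hn
    rw [mem_filter, mem_posRange, mem_Icc] at hn
    rw [mem_filter, mem_Ioc, eval_prod]
    exact ⟨⟨hn.1.1.1, hn.1.1.2⟩, hn.2⟩
  have hdiff : ((Ioc 0 x).filter fun n : ℕ =>
        (m : ℤ) ∣ (f i).eval (n : ℤ) ∧ (e : ℤ) ∣ (∏ j, f j).eval (n : ℤ)) \
      (posRange f x).filter (fun n : ℕ =>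
        ((m : ℤ) ∣ (f i).eval (n : ℤ)) ∧ ((e : ℤ) ∣ ∏ j, (f j).eval (n : ℤ))) ⊆ range n₀ := by
    intro n hn
    rw [Finset.mem_sdiff] at hn
    obtain ⟨hn1, hn2⟩ := hn
    rw [mem_range]
    by_contra hlt
    push Not at hlt
    apply hn2
    rw [mem_filter, mem_Ioc, eval_prod] at hn1
    rw [mem_filter, mem_posRange, mem_Icc]
    exact ⟨⟨⟨hn1.1.1, hn1.1.2⟩, hn₀ n hlt⟩, hn1.2⟩
  refine ⟨card_le_card hsub, ?_⟩
  calc _ ≤ _ := card_le_card_sdiff_add_card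
    _ ≤ n₀ + _ := Nat.add_le_add_right ((card_le_card hdiff).trans (card_range n₀).le) _
    _ = _ := add_comm _ _

/-- Bookkeeping: if `W ≤ A ≤ W + n₀` and `|A − M| ≤ B` then `|W − M| ≤ B + n₀`. [folklore] -/
private theorem abs_sub_le_of_sandwich {W A n₀ : ℕ} {M B : ℝ} (h1 : W ≤ A) (h2 : A ≤ W + n₀)
    (h : |(A : ℝ) - M| ≤ B) : |(W : ℝ) - M| ≤ B + n₀ := by
  have h1' : (W : ℝ) ≤ A := by exact_mod_cast h1
  have h2' : (A : ℝ) ≤ W + n₀ := by exact_mod_cast h2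
  rw [abs_le] at h ⊢
  constructor <;> linarith [h.1, h.2]

/-- **Pointwise remainder bound.**  If every `fⱼ(n) > 0` for `n ≥ n₀`, then for `e, m ≥ 1` coprime
with `ρᵢ(m) ≤ 1`: `|r(x; m, e)| ≤ e + n₀` (CRT count, `ρ_F(e) ≤ e`, and the restriction to
`posRange f x`). [folklore] -/
theorem abs_windowPairRem_le {k : ℕ} {f : Fin k → ℤ[X]} (i : Fin k) {n₀ : ℕ}
    (hn₀ : ∀ n : ℕ, n₀ ≤ n → ∀ j, 0 < (f j).eval (n : ℤ)) {x m e : ℕ} (hm : 0 < m) (he : 0 < e)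
    (hem : e.Coprime m) (hρ : polyRootCountMod ![f i] m ≤ 1) :
    |windowPairRem f i x m e| ≤ (e : ℝ) + n₀ := by
  have hW := windowPairCount_le_and_le f i hn₀ x m e
  have hcrt := abs_card_filter_dvd_pair_sub_le (f i) (∏ j, f j) hm he hem x
  rw [← PolyPrimeCountBrun.polyRootCountMod_eq_single_prod f e] at hcrt
  have hρF : (polyRootCountMod f e : ℝ) ≤ e := by exact_mod_cast polyRootCountMod_le f e
  have hρi : (polyRootCountMod ![f i] m : ℝ) ≤ 1 := by exact_mod_cast hρ
  have hprod : (polyRootCountMod ![f i] m : ℝ) * (polyRootCountMod f e) ≤ e := by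
    calc (polyRootCountMod ![f i] m : ℝ) * (polyRootCountMod f e)
        ≤ 1 * (e : ℝ) := mul_le_mul hρi hρF (Nat.cast_nonneg _) zero_le_one
      _ = e := one_mul _
  unfold windowPairRem
  have := abs_sub_le_of_sandwich hW.1 hW.2 hcrt
  linarith

/-- Exponent bookkeeping: for `x ≥ 1` with `x^{1/16} ≥ 4`, `n + 1 ≤ x^c`, `0 < c ≤ 1/8`, `δ ≤ c`:
`x^c·((x^{(1+δ)/2} + 1)·(x^c + n)) ≤ x^{1 − 1/8}`. [folklore] -/
private theorem rpow_budget {x : ℕ} {c δ n : ℝ} (hx : 1 ≤ x) (hc₀ : c ≤ 1 / 8)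
    (hδc : δ ≤ c) (h16 : 4 ≤ (x : ℝ) ^ (1 / 16 : ℝ)) (hn : n + 1 ≤ (x : ℝ) ^ c) (hn0 : 0 ≤ n) :
    (x : ℝ) ^ c * ((((x : ℝ) ^ ((1 + δ) / 2)) + 1) * ((x : ℝ) ^ c + n)) ≤
      (x : ℝ) ^ (1 - 1 / 8 : ℝ) := by
  have hX : (1 : ℝ) ≤ x := by exact_mod_cast hx
  have hXpos : (0 : ℝ) < x := by linarith
  have h1 : (x : ℝ) ^ c ≤ (x : ℝ) ^ (1 / 8 : ℝ) := Real.rpow_le_rpow_of_exponent_le hX hc₀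
  have h2 : (x : ℝ) ^ ((1 + δ) / 2) ≤ (x : ℝ) ^ (9 / 16 : ℝ) :=
    Real.rpow_le_rpow_of_exponent_le hX (by linarith)
  have h3 : (1 : ℝ) ≤ (x : ℝ) ^ (9 / 16 : ℝ) := Real.one_le_rpow hX (by norm_num)
  have e1 : (x : ℝ) ^ (1 / 8 : ℝ) * (x : ℝ) ^ (9 / 16 : ℝ) * (x : ℝ) ^ (1 / 8 : ℝ) =
      (x : ℝ) ^ (13 / 16 : ℝ) := by
    rw [← Real.rpow_add hXpos, ← Real.rpow_add hXpos]; norm_num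
  have e2 : (x : ℝ) ^ (1 / 16 : ℝ) * (x : ℝ) ^ (13 / 16 : ℝ) = (x : ℝ) ^ (1 - 1 / 8 : ℝ) := by
    rw [← Real.rpow_add hXpos]; norm_num
  have hB : (x : ℝ) ^ ((1 + δ) / 2) + 1 ≤ 2 * (x : ℝ) ^ (9 / 16 : ℝ) := by linarith
  have hC : (x : ℝ) ^ c + n ≤ 2 * (x : ℝ) ^ (1 / 8 : ℝ) := by linarith
  have hB0 : (0 : ℝ) ≤ (x : ℝ) ^ ((1 + δ) / 2) + 1 := by positivity
  have hC0 : (0 : ℝ) ≤ (x : ℝ) ^ c + n := by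
    have : (0 : ℝ) ≤ (x : ℝ) ^ c := by positivity
    linarith
  calc (x : ℝ) ^ c * ((((x : ℝ) ^ ((1 + δ) / 2)) + 1) * ((x : ℝ) ^ c + n))
      ≤ (x : ℝ) ^ (1 / 8 : ℝ) * ((2 * (x : ℝ) ^ (9 / 16 : ℝ)) * (2 * (x : ℝ) ^ (1 / 8 : ℝ))) :=
        mul_le_mul h1 (mul_le_mul hB hC hC0 (by positivity)) (mul_nonneg hB0 hC0) (by positivity)
    _ = 4 * ((x : ℝ) ^ (1 / 8 : ℝ) * (x : ℝ) ^ (9 / 16 : ℝ) * (x : ℝ) ^ (1 / 8 : ℝ)) := by ring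
    _ = 4 * (x : ℝ) ^ (13 / 16 : ℝ) := by rw [e1]
    _ ≤ (x : ℝ) ^ (1 / 16 : ℝ) * (x : ℝ) ^ (13 / 16 : ℝ) := by gcongr
    _ = (x : ℝ) ^ (1 - 1 / 8 : ℝ) := e2

/-! ### The anchor -/

/-- **`stub_roughWindowTypeI_degOne`** (sanity anchor of the skeleton
`Cruxes/BalancedSemiprimeLayer/Lines/rough_relaxed_divisor_sieve_c1.lean`): for every Bateman–Horn
system and every coordinate of degree `1`, the rough balanced-divisor line has level `x^c`
(`c ≤ c₀ = 1/8`, saving `η = 1/8`) in the sense of `RoughWindowTypeI` — every modulus `me < x`, so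
every remainder is `≤ ρ_F(e)·ρᵢ(m) + n₀ ≤ x^c + n₀` (`abs_windowPairRem_le`), and there are
`≤ x^c·(x^{(1+δ)/2} + 1)` pairs of moduli. [folklore] -/
theorem stub_roughWindowTypeI_degOne :
    ∀ (k : ℕ) (f : Fin k → ℤ[X]), IsBatemanHornSystem f → ∀ i : Fin k,
      (f i).natDegree = 1 → RoughWindowTypeI f i := by
  intro k f hf i hdeg
  obtain ⟨n₀, hn₀⟩ := exists_forall_eval_pos hf
  refine ⟨1 / 8, by norm_num, fun c hc hc₀ δ hδ hδc => ⟨1 / 8, by norm_num, ?_⟩⟩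
  -- pointwise bound on the remainders, for every `x`
  have hpt : ∀ x : ℕ, ∀ e ∈ (Icc 1 ⌊(x : ℝ) ^ c⌋₊).filter Squarefree,
      ∀ m ∈ roughDivWindow (f i).natDegree δ c x,
        |windowPairRem f i x m e| ≤ (x : ℝ) ^ c + n₀ := by
    intro x e he m hm
    rw [mem_filter, mem_Icc] at he
    rw [mem_roughDivWindow] at hm
    obtain ⟨⟨he1, hex⟩, -⟩ := he
    obtain ⟨-, hmsq, hmr⟩ := hm
    have he0 : 0 < e := he1
    have hm0 : 0 < m := Nat.pos_of_ne_zero hmsq.ne_zero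
    have hxc0 : (0 : ℝ) ≤ (x : ℝ) ^ c := Real.rpow_nonneg (Nat.cast_nonneg _) _
    have hexc : (e : ℝ) ≤ (x : ℝ) ^ c := (Nat.cast_le.mpr hex).trans (Nat.floor_le hxc0)
    have hem : e.Coprime m := Nat.coprime_of_dvd fun p hp hpe hpm => by
      have h1 : (p : ℝ) ≤ e := Nat.cast_le.mpr (Nat.le_of_dvd he0 hpe)
      have h2 := hmr p hp hpm
      linarith
    have hρ : polyRootCountMod ![f i] m ≤ 1 :=
      polyRootCountMod_single_le_one_of_squarefree (f i) m hmsq fun p hp _ =>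
        (BatemanHornMertens.rootCount_single_le_natDegree hf i hp).trans hdeg.le
    exact (abs_windowPairRem_le i hn₀ hm0 he0 hem hρ).trans (by linarith)
  -- sizes of the two ranges of moduli
  have hE : ∀ x : ℕ, (#((Icc 1 ⌊(x : ℝ) ^ c⌋₊).filter Squarefree) : ℝ) ≤ (x : ℝ) ^ c := by
    intro x
    have hxc0 : (0 : ℝ) ≤ (x : ℝ) ^ c := Real.rpow_nonneg (Nat.cast_nonneg _) _
    calc (#((Icc 1 ⌊(x : ℝ) ^ c⌋₊).filter Squarefree) : ℝ) ≤ #(Icc 1 ⌊(x : ℝ) ^ c⌋₊) := by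
          exact_mod_cast card_filter_le _ _
      _ = ⌊(x : ℝ) ^ c⌋₊ := by rw [Nat.card_Icc, Nat.add_sub_cancel]
      _ ≤ (x : ℝ) ^ c := Nat.floor_le hxc0
  have hM : ∀ x : ℕ, (#(roughDivWindow (f i).natDegree δ c x) : ℝ) ≤
      (x : ℝ) ^ ((1 + δ) / 2) + 1 := by
    intro x
    have hx0 : (0 : ℝ) ≤ (x : ℝ) ^ ((1 + δ) / 2) := Real.rpow_nonneg (Nat.cast_nonneg _) _
    calc (#(roughDivWindow (f i).natDegree δ c x) : ℝ) ≤ #(divWindow (f i).natDegree δ x) := by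
          exact_mod_cast card_filter_le _ _
      _ ≤ (⌊(x : ℝ) ^ (((f i).natDegree : ℝ) * (1 + δ) / 2)⌋₊ : ℝ) + 1 := by
          unfold divWindow
          rw [Nat.card_Icc]
          exact_mod_cast Nat.sub_le _ _
      _ = (⌊(x : ℝ) ^ ((1 + δ) / 2)⌋₊ : ℝ) + 1 := by rw [hdeg, Nat.cast_one, one_mul]
      _ ≤ (x : ℝ) ^ ((1 + δ) / 2) + 1 := by linarith [Nat.floor_le hx0]
  -- eventuality: `x ≥ 1`, `x^{1/16} ≥ 4`, `x^c ≥ n₀ + 1`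
  have hT : Tendsto (fun x : ℕ => (x : ℝ) ^ (1 / 16 : ℝ)) atTop atTop :=
    (tendsto_rpow_atTop (by norm_num)).comp tendsto_natCast_atTop_atTop
  have hTc : Tendsto (fun x : ℕ => (x : ℝ) ^ c) atTop atTop :=
    (tendsto_rpow_atTop hc).comp tendsto_natCast_atTop_atTop
  filter_upwards [hT.eventually_ge_atTop 4, hTc.eventually_ge_atTop ((n₀ : ℝ) + 1),
    eventually_ge_atTop 1] with x hx16 hxn₀ hx1
  calc ∑ e ∈ (Icc 1 ⌊(x : ℝ) ^ c⌋₊).filter Squarefree,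
        |∑ m ∈ roughDivWindow (f i).natDegree δ c x, windowPairRem f i x m e|
      ≤ ∑ e ∈ (Icc 1 ⌊(x : ℝ) ^ c⌋₊).filter Squarefree,
          ∑ m ∈ roughDivWindow (f i).natDegree δ c x, |windowPairRem f i x m e| :=
        Finset.sum_le_sum fun e _ => Finset.abs_sum_le_sum_abs _ _
    _ ≤ ∑ e ∈ (Icc 1 ⌊(x : ℝ) ^ c⌋₊).filter Squarefree,
          ∑ m ∈ roughDivWindow (f i).natDegree δ c x, ((x : ℝ) ^ c + n₀) :=
        Finset.sum_le_sum fun e he => Finset.sum_le_sum fun m hm => hpt x e he m hm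
    _ = (#((Icc 1 ⌊(x : ℝ) ^ c⌋₊).filter Squarefree) : ℝ) *
          ((#(roughDivWindow (f i).natDegree δ c x) : ℝ) * ((x : ℝ) ^ c + n₀)) := by
        simp only [Finset.sum_const, nsmul_eq_mul]
    _ ≤ (x : ℝ) ^ c * ((((x : ℝ) ^ ((1 + δ) / 2)) + 1) * ((x : ℝ) ^ c + n₀)) := by
        gcongr ?_ * (?_ * _)
        · exact hE x
        · exact hM x
    _ ≤ (x : ℝ) ^ (1 - 1 / 8 : ℝ) := rpow_budget hx1 hc₀ hδc hx16 hxn₀ (Nat.cast_nonneg n₀)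

end Summit.Parity.BatemanHorn.Cruxes.BalancedSemiprimeLayer.RoughRelaxedDivisorSieve
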